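import Literature.Probability.LatticeModels.CurrentsPartialMonotonicity
import Literature.Probability.LatticeModels.IsingThermodynamics
import Literature.Probability.LatticeModels.ThermodynamicLimit
import Mathlib.Analysis.SpecialFunctions.Trigonometric.Deriv

/-!
# Sketch — first lemmas of the crux ideas for `PerfectScreening.CoulombImpliesNontrivial`
(crux item stmt-CriticalPhenomena-13885; ideator 1, round 1). Statements only (`def … : Prop`),
over existing declarations; nothing here is a route item.
-/

noncomputable section

namespace Summit.CriticalPhenomena.Ising3DConformalLimit.Cruxes.CoulombImpliesNontrivial.Sketch

open Literature.Probability.LatticeModels Finset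
open scoped symmDiff ENNReal

/-! ## Card `merging-is-expected-screening` -/

/-- FIRST LEMMA (A1) — MERGE–SCREENING IDENTITY (finite graph, couplings `K ≥ 0`, current-sum
form; an instance of ADC 2021 Lemma A.1 = tree `Current.tsum_epairWeight_eq_tsum_mul_offRatio`
with `s = x`, `A = {x}Δ{y}`, `B = {z}Δ{t}`, `F = 𝟙[z ∉ C ∧ t ∉ C]`):
`Σ 1{∂n₁=xy}1{∂n₂=zt} w w 𝟙[z,t ∉ C_{n₁+n₂}(x)]
   = Σ 1{∂n₁=xy}1{∂n₂=∅} w w 𝟙[z,t ∉ C] · Z_{G∖C}[zt]/Z_{G∖C}[∅]`, `C = C_{n₁+n₂}(x)`;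
i.e. `P^{xy,zt}[x ↮ z] = E^{xy,∅}[ 𝟙[z,t ∉ C] ⟨σ_zσ_t⟩_{Λ∖C} / ⟨σ_zσ_t⟩_Λ ]`, so that by ADC (3.11)
`-U₄(x,y,z,t) / (2⟨σ_xσ_y⟩⟨σ_zσ_t⟩) = E^{xy,∅}[ 1 - 𝟙[z,t ∉ C] ⟨σ_zσ_t⟩_{Λ∖C}/⟨σ_zσ_t⟩_Λ ]`:
the merging probability IS the expected relative screening of `⟨σ_zσ_t⟩` by the independent
sourced⊗sourceless double cluster of `x`. -/
def MergeScreeningIdentity : Prop :=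
  ∀ (V : Type) [Fintype V] [DecidableEq V] (G : SimpleGraph V) [DecidableRel G.Adj]
    (K : G.edgeFinset → ℝ), (∀ e, 0 ≤ K e) → ∀ x y z t : V,
    ∑' p : Current G × Current G, epairWeight K ({x} ∆ {y}) ({z} ∆ {t}) p *
        (if z ∈ (p.1 + p.2).cluster x ∨ t ∈ (p.1 + p.2).cluster x then 0 else 1) =
      ∑' p : Current G × Current G, epairWeight K ({x} ∆ {y}) ∅ p *
        ((if z ∈ (p.1 + p.2).cluster x ∨ t ∈ (p.1 + p.2).cluster x then 0 else 1) *
          Current.offRatio K ((p.1 + p.2).cluster x) ({z} ∆ {t}))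

/-- (A1') The inequality form the line uses: for any family `good : Finset V → Prop` of clusters
and any `κ ≤ 1`, if every `T` with `good T`, `z ∉ T`, `t ∉ T` SCREENS the pair `zt` by `κ`
(`Z_{G∖T}[zt] · Z[∅] ≤ (1-κ) · Z_{G∖T}[∅] · Z[zt]`, i.e. `⟨σ_zσ_t⟩_{Λ∖T} ≤ (1-κ)⟨σ_zσ_t⟩_Λ`), then
`κ · Z[zt] · (mass of {∂n₁=xy, ∂n₂=∅, C good, z,t ∉ C}) ≤ Z[∅] · (mass of {∂n₁=xy, ∂n₂=zt, x ↔ z})`,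
i.e. `P^{xy,zt}[merge] ≥ κ · P^{xy,∅}[C_{n₁+n₂}(x) good, ∌ z,t]`. (From A1 and `offRatio ≤ (1-κ)·…`.) -/
def MergeFromScreening : Prop :=
  ∀ (V : Type) [Fintype V] [DecidableEq V] (G : SimpleGraph V) [DecidableRel G.Adj]
    (K : G.edgeFinset → ℝ), (∀ e, 0 ≤ K e) → ∀ (x y z t : V) (good : Finset V → Prop) [DecidablePred good] (κ : ℝ≥0∞),
    κ ≤ 1 →
    (∀ T : Finset V, good T → z ∉ T → t ∉ T →
      ecurrentSumIn (offGraph G T) K ({z} ∆ {t}) * ecurrentSum K ∅ ≤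
        (1 - κ) * ecurrentSumIn (offGraph G T) K ∅ * ecurrentSum K ({z} ∆ {t})) →
    κ * ecurrentSum K ({z} ∆ {t}) *
        ∑' p : Current G × Current G, epairWeight K ({x} ∆ {y}) ∅ p *
          (if good ((p.1 + p.2).cluster x) ∧ z ∉ (p.1 + p.2).cluster x ∧ t ∉ (p.1 + p.2).cluster x
            then 1 else 0) ≤
      ecurrentSum K ∅ *
        ∑' p : Current G × Current G, epairWeight K ({x} ∆ {y}) ({z} ∆ {t}) p * Current.connInd z x p

/-- (A2) CAPACITY SCREENING ON `ℤ³` AT `β_c` — the one new conjecture of the line (deterministic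
obstacle; no currents): a finite set `A` of 'macroscopic Newtonian capacity' sitting in the middle
eighth between `z` and `t` (here certified by the two PZ-friendly numbers `#A ≥ c₁R²` and Coulomb
energy `Σ_{u≠v∈A} ‖u-v‖⁻¹ ≤ C₁R³`, which give `Cap(A) ≳ (c₁²/C₁)R`) depresses the free-box
two-point function between `z` and `t` by a factor `1-κ` uniformly in the box: with
`Λ = box 3 L ∖ A` (free b.c. on `Λ` = all edges meeting `A` deleted),
`⟨σ_zσ_t⟩^{free}_{box L ∖ A, β_c} ≤ (1-κ) ⟨σ_zσ_t⟩⁺_{β_c}` for all `L ≥ L₀`. (`‖·‖` = sup norm on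
`Site 3`.) Expected TRUE in every dimension (random-walk caricature: screening = hitting
probability ≍ Cap(A)/R); the `d = 3` input of the line is elsewhere (A3). -/
def CapacityScreening : Prop :=
  ∀ c₁ C₁ : ℝ, 0 < c₁ → 0 < C₁ → ∃ κ R₀ : ℝ, 0 < κ ∧ ∀ (z t : Site 3) (A : Finset (Site 3)),
    R₀ ≤ ‖t - z‖ → z ∉ A → t ∉ A →
    (∀ a ∈ A, 8 * ‖2 • a - z - t‖ ≤ ‖t - z‖) →
    c₁ * ‖t - z‖ ^ 2 ≤ (A.card : ℝ) →
    (∑ u ∈ A, ∑ v ∈ A.erase u, ‖u - v‖⁻¹) ≤ C₁ * ‖t - z‖ ^ 3 →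
    ∃ L₀ : ℕ, ∀ L : ℕ, L₀ ≤ L →
      isingTwoPoint (zdGraph 3) (box 3 L \ A) (criticalBeta 3) 0 .free z t ≤
        (1 - κ) * criticalTwoPoint 3 (t - z)

/-- (A3, provable now under the crux hypothesis; words only) DOUBLE-CLUSTER CAPACITY: under
`c/‖x‖ ≤ G ≤ C/‖x‖`, for `x,y,z,t` at mutual sup-distances in `[R, 2R]` the sourced⊗sourceless
double cluster `C = C_{n₁+n₂}(x)` (`∂n₁ = {x,y}`, `∂n₂ = ∅`, box `L → ∞`) satisfies with
probability `≥ c′ > 0`: `z,t ∉ C`, `#(C ∩ B) ≥ c₁R²`, `Σ_{u≠v ∈ C∩B}‖u-v‖⁻¹ ≤ C₁R³`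
(`B` = middle eighth). Inputs, all in tree: exact density `P[u ∈ C] = Z[xu]Z[uy]/(Z[xy]Z[∅])`
(`Current.tsum_epairWeight_mul_indicator_mem_cluster`), pair bound ADC Prop. A.3
(`Current.ecurrentSum_empty_mul_tsum_double_conn_le`), Paley–Zygmund
(`Current.tsum_mul_sq_le_tsum_indicator_mul_tsum_sq`), Markov. Dimension count: `E#(C∩B) ≍ R²`,
`E#² ≲ R⁴`, `E[energy] ≲ R³`; in `d ≥ 5` the same numbers give relative capacity `R⁻¹ → 0`
(and `(log R)⁻¹` in `d = 4`): this is where the line is `d = 3`-specific. -/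
def DoubleClusterCapacityInformal : Prop := True

/-! ## Card `energy-insertion-single-current-mass` -/

/-- FIRST LEMMA (B1) — ENERGY-INSERTION MASS INEQUALITY (finite graph, uniform coupling `β > 0`,
current-sum form). For an edge `uv` and sources `{x}Δ{z}`:
`tanh β · Z[{x}Δ{z}Δ{u}Δ{v}] · Z[∅] ≤ Z[∅] · M + tanh β · Z[{x}Δ{z}] · Z[{u}Δ{v}]`,
where `M = Σ_{∂n = {x}Δ{z}} w(n) 𝟙[u ∈ C_n(x) ∨ v ∈ C_n(x)]` is the SINGLE-current mass of
"the cluster of the source `x` touches the edge `uv`"; i.e.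
`P^{xz}[C_n(x) ∩ {u,v} ≠ ∅] ≥ tanh β · ⟨σ_xσ_z ; σ_uσ_v⟩ / ⟨σ_xσ_z⟩`
— the single sourced cluster is at least as heavy as `tanh β/β` times the EXCESS current
`E^{xz}[n_{uv}] - E^{∅}[n_{uv}] = β⟨σ_xσ_z;σ_uσ_v⟩/⟨σ_xσ_z⟩` it must carry. Proof sketch:
`E^{A}[n_e] = β ∂_{β_e} log Z[A] = β⟨σ_Aσ_uσ_v⟩/⟨σ_A⟩`; conditioning on `C = C_n(x)` the rest is a
sourceless current on `G ∖ C` (tree: cluster decoupling `Current.tsum_pair_eq_sum_cluster`), so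
`E^{xz}[n_e ; e ⊄ C] = E^{xz}[𝟙(u,v ∉ C) β⟨σ_uσ_v⟩_{G∖C}] ≤ β⟨σ_uσ_v⟩ P^{xz}[u,v ∉ C]` (Griffiths,
tree `Current.offRatio_pair_mul_le`); and `E^{xz}[n_e ; u,v ∈ C] ≤ β coth β · P^{xz}[u or v ∈ C_{n-e}(x)]`
(given `n` off `e`, `n_e` is a parity-conditioned Poisson(β) variable, mean `≤ β coth β`). -/
def EnergyInsertionMass : Prop :=
  ∀ (V : Type) [Fintype V] [DecidableEq V] (G : SimpleGraph V) [DecidableRel G.Adj] (β : ℝ),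
    0 < β → ∀ (x z u v : V), G.Adj u v →
    ENNReal.ofReal (Real.tanh β) * ecurrentSum (fun _ : G.edgeFinset => β) ({x} ∆ {z} ∆ ({u} ∆ {v})) *
        ecurrentSum (fun _ : G.edgeFinset => β) ∅ ≤
      ecurrentSum (fun _ : G.edgeFinset => β) ∅ *
          (∑' n : Current G,
            if n.sources = {x} ∆ {z} ∧ (u ∈ n.cluster x ∨ v ∈ n.cluster x)
            then n.eweight (fun _ : G.edgeFinset => β) else 0) +
        ENNReal.ofReal (Real.tanh β) * ecurrentSum (fun _ : G.edgeFinset => β) ({x} ∆ {z}) *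
          ecurrentSum (fun _ : G.edgeFinset => β) ({u} ∆ {v})

/-- (B2) The companion switching inequality (adjacent-source merging ≥ G(uv) × single/double ratio):
`Z[{x}Δ{u}]Z[{z}Δ{v}] · P^{xu,zv}[x ↔ z]  (= Z[{x}Δ{z}]Z[{u}Δ{v}] · P^{xz,uv}[x ↔ u] by switching)
 ≥ Z[{u}Δ{v}] · Σ_{∂n={x}Δ{z}} w(n) 𝟙[u ∈ C_n(x)]`, since `u ∈ C_{n₁}(x) ⊆ C_{n₁+n₂}(x)`. -/
def AdjacentMergeFromSingle : Prop :=
  ∀ (V : Type) [Fintype V] [DecidableEq V] (G : SimpleGraph V) [DecidableRel G.Adj]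
    (K : G.edgeFinset → ℝ), (∀ e, 0 ≤ K e) → ∀ (x z u v : V),
    ecurrentSum K ({u} ∆ {v}) *
        (∑' n : Current G, if n.sources = {x} ∆ {z} ∧ u ∈ n.cluster x then n.eweight K else 0) ≤
      ∑' p : Current G × Current G, epairWeight K ({x} ∆ {z}) ({u} ∆ {v}) p * Current.connInd u x p

end Summit.CriticalPhenomena.Ising3DConformalLimit.Cruxes.CoulombImpliesNontrivial.Sketch

/-! ## Appendix: the first lemma of card A is provable now -/

namespace Summit.CriticalPhenomena.Ising3DConformalLimit.Cruxes.CoulombImpliesNontrivial.Sketch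

open Literature.Probability.LatticeModels Finset
open scoped symmDiff ENNReal

/-- `MergeScreeningIdentity` holds: it is the instance `F = 𝟙[z,t ∉ C_{n₁+n₂}(x)]` of the tree's ADC Lemma A.1
(`Current.tsum_epairWeight_eq_tsum_mul_offRatio`). -/
theorem mergeScreeningIdentity_holds : MergeScreeningIdentity := by
  intro V _ _ G _ K hK x y z t
  refine Current.tsum_epairWeight_eq_tsum_mul_offRatio hK x ({x} ∆ {y}) ({z} ∆ {t})
    (fun p => if z ∈ (p.1 + p.2).cluster x ∨ t ∈ (p.1 + p.2).cluster x then 0 else 1) ?_ ?_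
  · intro n₁ n₂ n₂' h
    simp only [Current.cluster_add_congr_right h]
  · intro n₁ n₂ _ _ hF
    have hzt : z ∉ (n₁ + n₂).cluster x ∧ t ∉ (n₁ + n₂).cluster x := by
      by_contra hc
      apply hF
      rw [if_pos (by tauto)]
    rw [Finset.disjoint_right]
    intro w hw hwC
    rcases Current.eq_or_eq_of_mem_symmDiff_singleton hw with rfl | rfl
    · exact hzt.1 hwC
    · exact hzt.2 hwC


/-- `MergeFromScreening` holds (the working inequality of card A: merge mass ≥ κ × mass of good screened
clusters), from `mergeScreeningIdentity_holds`, Griffiths (`Current.offRatio_pair_mul_le`) and bookkeeping. -/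
theorem mergeFromScreening_holds : MergeFromScreening := by
  intro V _ _ G _ K hK x y z t good _ κ hκ hscreen
  classical
  -- abbreviations
  have hId := mergeScreeningIdentity_holds V G K hK x y z t
  have hZ0 : ecurrentSum K (∅ : Finset V) ≠ 0 := ecurrentSum_empty_ne_zero K
  have hZ0top : ecurrentSum K (∅ : Finset V) ≠ ∞ := ecurrentSum_ne_top hK ∅
  -- (1) complementary split of the `(xy, zt)` pair weights into `conn` and `z,t ∉ C`
  have hsplit : (∑' p : Current G × Current G, epairWeight K ({x} ∆ {y}) ({z} ∆ {t}) p * Current.connInd z x p) +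
      (∑' p : Current G × Current G, epairWeight K ({x} ∆ {y}) ({z} ∆ {t}) p *
        (if z ∈ (p.1 + p.2).cluster x ∨ t ∈ (p.1 + p.2).cluster x then 0 else 1)) =
      ecurrentSum K ({x} ∆ {y}) * ecurrentSum K ({z} ∆ {t}) := by
    rw [← ENNReal.tsum_add, ← tsum_epairWeight K ({x} ∆ {y}) ({z} ∆ {t})]
    refine tsum_congr fun p => ?_
    rw [← mul_add]
    by_cases hs2 : p.2.sources = {z} ∆ {t}
    · have htz : t ∈ (p.1 + p.2).cluster z := Current.mem_cluster_add_of_sources_eq_right p.1 hs2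
      have hzt : t ∈ (p.1 + p.2).cluster x → z ∈ (p.1 + p.2).cluster x := fun ht =>
        Current.mem_cluster_trans ht (Current.mem_cluster_comm.1 htz)
      have hzt' : z ∈ (p.1 + p.2).cluster x → t ∈ (p.1 + p.2).cluster x := fun hz =>
        Current.mem_cluster_trans hz htz
      unfold Current.connInd
      by_cases hz : z ∈ (p.1 + p.2).cluster x
      · simp [hz]
      · have ht : t ∉ (p.1 + p.2).cluster x := fun ht => hz (hzt ht)
        simp [hz, ht]
    · have hw : epairWeight K ({x} ∆ {y}) ({z} ∆ {t}) p = 0 := by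
        unfold epairWeight
        rw [if_neg (fun h => hs2 h.2)]
      simp [hw]
  -- (2) termwise bound after the identity: Z[∅]·D + κ·Z[zt]·M' ≤ Z[zt]·(Z[xy]·Z[∅])
  have hterm : ∀ p : Current G × Current G,
      ecurrentSum K ∅ * (epairWeight K ({x} ∆ {y}) ∅ p *
          ((if z ∈ (p.1 + p.2).cluster x ∨ t ∈ (p.1 + p.2).cluster x then 0 else 1) *
            Current.offRatio K ((p.1 + p.2).cluster x) ({z} ∆ {t}))) +
        κ * ecurrentSum K ({z} ∆ {t}) * (epairWeight K ({x} ∆ {y}) ∅ p *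
          (if good ((p.1 + p.2).cluster x) ∧ z ∉ (p.1 + p.2).cluster x ∧ t ∉ (p.1 + p.2).cluster x
            then 1 else 0)) ≤
      ecurrentSum K ({z} ∆ {t}) * epairWeight K ({x} ∆ {y}) ∅ p := by
    intro p
    set T := (p.1 + p.2).cluster x with hT
    set w := epairWeight K ({x} ∆ {y}) ∅ p with hw
    by_cases hzt : z ∈ T ∨ t ∈ T
    · have h2 : ¬ (good T ∧ z ∉ T ∧ t ∉ T) := fun h => by rcases hzt with hz | ht; exacts [h.2.1 hz, h.2.2 ht]
      rw [if_pos hzt, if_neg h2]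
      simp
    · push Not at hzt
      rw [if_neg (by tauto)]
      -- Griffiths: offRatio · Z[∅] ≤ Z[zt]
      have hG : Current.offRatio K T ({z} ∆ {t}) * ecurrentSum K ∅ ≤ ecurrentSum K ({z} ∆ {t}) :=
        Current.offRatio_pair_mul_le hK T z t
      by_cases hg : good T
      · rw [if_pos ⟨hg, hzt.1, hzt.2⟩, mul_one, one_mul]
        -- screening: offRatio · Z[∅] ≤ (1-κ) Z[zt]
        have hS : Current.offRatio K T ({z} ∆ {t}) * ecurrentSum K ∅ ≤ (1 - κ) * ecurrentSum K ({z} ∆ {t}) := by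
          have h0 : ecurrentSumIn (offGraph G T) K (∅ : Finset V) ≠ 0 :=
            (lt_of_lt_of_le zero_lt_one (one_le_ecurrentSumIn_empty _ K)).ne'
          have htop : ecurrentSumIn (offGraph G T) K (∅ : Finset V) ≠ ∞ := ecurrentSumIn_ne_top _ hK _
          have key := hscreen T hg hzt.1 hzt.2
          have hoff : Current.offRatio K T ({z} ∆ {t}) * ecurrentSumIn (offGraph G T) K ∅ =
              ecurrentSumIn (offGraph G T) K ({z} ∆ {t}) := Current.offRatio_mul_ecurrentSumIn_empty hK T _
          have : Current.offRatio K T ({z} ∆ {t}) * ecurrentSum K ∅ * ecurrentSumIn (offGraph G T) K ∅ ≤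
              (1 - κ) * ecurrentSum K ({z} ∆ {t}) * ecurrentSumIn (offGraph G T) K ∅ := by
            calc Current.offRatio K T ({z} ∆ {t}) * ecurrentSum K ∅ * ecurrentSumIn (offGraph G T) K ∅
                = ecurrentSumIn (offGraph G T) K ({z} ∆ {t}) * ecurrentSum K ∅ := by rw [← hoff]; ring
              _ ≤ (1 - κ) * ecurrentSumIn (offGraph G T) K ∅ * ecurrentSum K ({z} ∆ {t}) := key
              _ = (1 - κ) * ecurrentSum K ({z} ∆ {t}) * ecurrentSumIn (offGraph G T) K ∅ := by ring
          exact (ENNReal.mul_le_mul_iff_left h0 htop).1 this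
        calc ecurrentSum K ∅ * (w * Current.offRatio K T ({z} ∆ {t})) + κ * ecurrentSum K ({z} ∆ {t}) * w
            = w * (Current.offRatio K T ({z} ∆ {t}) * ecurrentSum K ∅) + w * (κ * ecurrentSum K ({z} ∆ {t})) := by ring
          _ ≤ w * ((1 - κ) * ecurrentSum K ({z} ∆ {t})) + w * (κ * ecurrentSum K ({z} ∆ {t})) :=
              add_le_add (mul_le_mul' le_rfl hS) le_rfl
          _ = w * (((1 - κ) + κ) * ecurrentSum K ({z} ∆ {t})) := by ring
          _ = ecurrentSum K ({z} ∆ {t}) * w := by rw [tsub_add_cancel_of_le hκ, one_mul, mul_comm]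
      · rw [if_neg (fun h => hg h.1), mul_zero, mul_zero, add_zero, one_mul]
        calc ecurrentSum K ∅ * (w * Current.offRatio K T ({z} ∆ {t}))
            = w * (Current.offRatio K T ({z} ∆ {t}) * ecurrentSum K ∅) := by ring
          _ ≤ w * ecurrentSum K ({z} ∆ {t}) := mul_le_mul' le_rfl hG
          _ = ecurrentSum K ({z} ∆ {t}) * w := mul_comm _ _
  have hbound : ecurrentSum K ∅ * (∑' p : Current G × Current G, epairWeight K ({x} ∆ {y}) ({z} ∆ {t}) p *
        (if z ∈ (p.1 + p.2).cluster x ∨ t ∈ (p.1 + p.2).cluster x then 0 else 1)) +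
      κ * ecurrentSum K ({z} ∆ {t}) * (∑' p : Current G × Current G, epairWeight K ({x} ∆ {y}) ∅ p *
        (if good ((p.1 + p.2).cluster x) ∧ z ∉ (p.1 + p.2).cluster x ∧ t ∉ (p.1 + p.2).cluster x
          then 1 else 0)) ≤
      ecurrentSum K ({z} ∆ {t}) * (ecurrentSum K ({x} ∆ {y}) * ecurrentSum K ∅) := by
    rw [hId, ← ENNReal.tsum_mul_left, ← ENNReal.tsum_mul_left, ← ENNReal.tsum_add, ← tsum_epairWeight K ({x} ∆ {y}) ∅,
      ← ENNReal.tsum_mul_left]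
    exact ENNReal.tsum_le_tsum hterm
  -- (3) finiteness of Z[∅]·D and cancellation
  have hDfin : ecurrentSum K ∅ * (∑' p : Current G × Current G, epairWeight K ({x} ∆ {y}) ({z} ∆ {t}) p *
        (if z ∈ (p.1 + p.2).cluster x ∨ t ∈ (p.1 + p.2).cluster x then 0 else 1)) ≠ ∞ := by
    refine ENNReal.mul_ne_top hZ0top (ne_top_of_le_ne_top ?_ (Current.tsum_epairWeight_mul_le _ _ fun p => ?_))
    · exact ENNReal.mul_ne_top (ecurrentSum_ne_top hK _) (ecurrentSum_ne_top hK _)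
    · split_ifs <;> simp
  have hkey : ecurrentSum K ∅ * (∑' p : Current G × Current G, epairWeight K ({x} ∆ {y}) ({z} ∆ {t}) p *
        (if z ∈ (p.1 + p.2).cluster x ∨ t ∈ (p.1 + p.2).cluster x then 0 else 1)) +
      κ * ecurrentSum K ({z} ∆ {t}) * (∑' p : Current G × Current G, epairWeight K ({x} ∆ {y}) ∅ p *
        (if good ((p.1 + p.2).cluster x) ∧ z ∉ (p.1 + p.2).cluster x ∧ t ∉ (p.1 + p.2).cluster x
          then 1 else 0)) ≤
      ecurrentSum K ∅ * (∑' p : Current G × Current G, epairWeight K ({x} ∆ {y}) ({z} ∆ {t}) p *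
        (if z ∈ (p.1 + p.2).cluster x ∨ t ∈ (p.1 + p.2).cluster x then 0 else 1)) +
      ecurrentSum K ∅ * (∑' p : Current G × Current G, epairWeight K ({x} ∆ {y}) ({z} ∆ {t}) p * Current.connInd z x p) := by
    calc _ ≤ ecurrentSum K ({z} ∆ {t}) * (ecurrentSum K ({x} ∆ {y}) * ecurrentSum K ∅) := hbound
      _ = ecurrentSum K ∅ * (ecurrentSum K ({x} ∆ {y}) * ecurrentSum K ({z} ∆ {t})) := by ring
      _ = _ := by rw [← hsplit, mul_add, add_comm]
  exact (ENNReal.add_le_add_iff_left hDfin).1 hkey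

end Summit.CriticalPhenomena.Ising3DConformalLimit.Cruxes.CoulombImpliesNontrivial.Sketch
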